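/-
Copyright (c) 2026 the pub-hodgecm-mathlib formalisation cell (harness21).  Prover seat hodgecm-mathlib-K2E3-p23 (g4), Track B «K2-LIT» ∕ h413
(`stmt-HodgeConjecture-24833`), line `K2_E3_EllipticInputs`, row 11 split road (owner K2E3-p11 (g4)), road «FC-GL» (line lead K2E3-p23 (g4); dealer D58), brick (GL-P).
2026-09-04.
-/
import Literature.NumberTheory.Automorphic.CartanDecompositionGLnPowers      -- ★ `exists_glInt_mul_mul_eq_zpowDiagGL`, `zpowDiagGL`, `glInt`
import Literature.NumberTheory.Automorphic.ReductiveGroupData                 -- ★ `glInt`, `isOpen_glInt`, `isCompact_glInt`, `mem_glInt_iff`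
import Literature.NumberTheory.Automorphic.ValuedFieldValuativeRelBridge      -- ★ `isUniformizingElement_of_v_eq`, `isDiscreteValuationRing_integer_of_compatible`, `v_le_one_iff_valuation_le_one`
import Literature.NumberTheory.Automorphic.TateLocalZetaShells                -- ★ `secondCountableTopology_localField`
import Literature.NumberTheory.Automorphic.SymplecticSimilitudeHyperspecialMaximalCompact  -- ★ `SymplecticCartan.isOpen_setOf_v_le_exp`, `exists_forall_v_le_exp_of_isCompact`
import Mathlib.Topology.Algebra.Group.Quotient
import Mathlib.LinearAlgebra.Matrix.GeneralLinearGroup.Defs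
import HarnessLib

/-!
# Crux `H413` — K2-LIT E3, row 11 SPLIT road, road «FC-GL» (the (S-D) organ), brick (GL-P): PLUMBING FOR `Ḡ = GL₃(F) ⧸ Z` — instances, the compact open
# `K̄`, scale-invariant sets and their images, the compactness criterion for centralisers, and the TWO-PARAMETER Cartan cover `Ḡ = ⋃_{a ≥ b ≥ 0} K̄ t̄_{a,b} K̄`

Cell `hodgecm-mathlib`, Track B, line `K2_E3_EllipticInputs`, socket U12 row 11 (11-3-split) via road «FC-GL» (deal D58 of K2E3-plan (g3); census
`K2/K2E3-p23/g4/CENSUS-SD-GL3Supercuspidal.K2E3-p23-g4.md`; RULINGS #1 of the line lead K2E3-p23 (g4)); seat K2E3-p23 (g4).  THEOREMS ONLY (no `def`, no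
`instance`, no notation, no named-fact hypothesis, no `sorry`); count-neutral helper (`--supports stmt-HodgeConjecture-24833 --as helper`).

THE MATHEMATICS.  `F` a non-archimedean local field of characteristic zero (`Valued` + compatible `ValuativeRel`), `G = GL (Fin 3) F`, `Z = Subgroup.center G`
(`= F^× · 1`, ★ `Matrix.GeneralLinearGroup.center_eq_range_scalar`), `Ḡ = G ⧸ Z` (Mathlib `QuotientGroup`: a second countable locally compact T2 topological group).
* §1 frame: `secondCountableTopology_gl3`, `locallyCompactSpace_gl3`, `isClosed_center_gl3` (so `Ḡ` is `T3`), `t2Space_quot`.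
* §2 SCALARS: `exists_scalar_of_mk_eq` (`mk x = mk y ⇒ y = x · c·1`), and for a SCALE-INVARIANT set `S ⊆ G` (`x ∈ S ↔ x·(c·1) ∈ S`): `preimage_mk_image_eq`
  (`mk ⁻¹' (mk '' S) = S`), `mk_mem_image_iff`, `isClosed_image_mk_of_scaleInvariant`, `isOpen_image_mk_of_scaleInvariant`.
* §3 `K̄ := (glInt 3 F).map (QuotientGroup.mk' Z)`: `isOpen_kbar`, `isCompact_kbar`.
* §4 **COMPACTNESS CRITERION** `exists_bound_of_isCompact_centralizer_mk` — if `Z_Ḡ(mk h)` is compact then the products `v(y i j) · v(y⁻¹ i' j')` are bounded on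
  `Z_G(h)` (scale-invariant bound; the consumer of (GL-6) «block Hensel ⇒ unbounded centraliser»).
* §5 **THE TWO-PARAMETER CARTAN COVER** `exists_mem_doubleCoset_mk_tPair` — every `ḡ ∈ Ḡ` lies in `K̄ · mk(t_{a,b}) · K̄` for some `a ≥ b ≥ 0`,
  `t_{a,b} = diag(ϖ^{−a}, ϖ^{−b}, 1) = zpowDiagGL ![−a, −b, 0]` (★ `exists_glInt_mul_mul_eq_zpowDiagGL` applied to `g⁻¹`, then divide by the scalar `ϖ^{a₂}`);
  `coe_conj_tPair_apply` — `(t h t⁻¹)ᵢⱼ = ϖ^{−eᵢ + eⱼ} hᵢⱼ`, `e = (a, b, 0)`.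

HONEST LABEL: HC_CM is proved only modulo the 7 printed citations (2 remaining named inputs: hLiu418 = stmt-HodgeConjecture-24832, h413 =
stmt-HodgeConjecture-24833) until rung 0 closes; local structure theory, closes no organ by itself.

## References
* [BruhatTits1972] F. Bruhat, J. Tits, *Groupes réductifs sur un corps local I*, Publ. Math. IHÉS 41 (1972), (4.4.3) (Cartan decomposition `G = K A⁺ K`).
* [Bump1997] D. Bump, *Automorphic Forms and Representations* (1997), Prop. 4.6.2, Thm. 3.3.3 (elementary divisors for `GL_n`).
* [Cartier1979] P. Cartier, *Representations of p-adic groups: a survey*, Proc. Sympos. Pure Math. 33.1 (1979), §I.3–I.4, §IV.1.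
* [PlatonovRapinchuk1994] V. Platonov, A. Rapinchuk, *Algebraic Groups and Number Theory* (1994), §3.3 (`GL_n(𝒪)` compact open; centre of `GL_n`).
-/

set_option autoImplicit false
-- the mandated namespace repeats `HodgeConjecture.HodgeConjecture`, as in every `Theorems/*.lean` of this sub-problem
set_option linter.dupNamespace false

noncomputable section

open Set ValuativeRel Matrix
open scoped MatrixGroups Pointwise WithZero Valued Topology

namespace Summit.HodgeConjecture.HodgeConjecture.Cruxes.H413.K2E3GL3ModCentre

open Literature.NumberTheory.Automorphic Literature.NumberTheory.GaloisRepresentations Literature.NumberTheory.GaloisRepresentations.IsNonarchimedeanLocalField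

/-! ## §1 The frame: `GL₃(F)` and `Ḡ = GL₃(F) ⧸ Z` -/

section Frame

variable {F : Type*} [Field F] [ValuativeRel F] [TopologicalSpace F] [IsNonarchimedeanLocalField F]

variable (F) in
/-- `GL₃(F)` is second countable (`F` is ★ `secondCountableTopology_localField`; `GL₃ ↪ M₃ × M₃ᵐᵒᵖ`). [cite: Cartier1979, §IV.1] -/
theorem secondCountableTopology_gl3 : SecondCountableTopology (GL (Fin 3) F) := by
  haveI : SecondCountableTopology F := secondCountableTopology_localField F
  haveI : SecondCountableTopology (Matrix (Fin 3) (Fin 3) F) := inferInstanceAs (SecondCountableTopology (Fin 3 → Fin 3 → F))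
  haveI : SecondCountableTopology (Matrix (Fin 3) (Fin 3) F)ᵐᵒᵖ := MulOpposite.opHomeomorph.symm.secondCountableTopology
  exact Units.isEmbedding_embedProduct.secondCountableTopology

variable (F) in
/-- `GL₃(F)` is locally compact (`M₃(F)` is, `F` locally compact T2). [cite: Cartier1979, §IV.1] -/
theorem locallyCompactSpace_gl3 : LocallyCompactSpace (GL (Fin 3) F) := by
  haveI : T2Space F := (isLocalField F).toT2Space
  haveI : LocallyCompactSpace F := (isLocalField F).toLocallyCompactSpace
  haveI : LocallyCompactSpace (Matrix (Fin 3) (Fin 3) F) := inferInstanceAs (LocallyCompactSpace (Fin 3 → Fin 3 → F))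
  infer_instance

variable (F) in
/-- The centre of `GL₃(F)` is closed (`GL₃(F)` is T2; the centre is the centraliser of everything). [cite: PlatonovRapinchuk1994, §3.3] -/
theorem isClosed_center_gl3 : IsClosed ((Subgroup.center (GL (Fin 3) F) : Set (GL (Fin 3) F))) := by
  haveI : T2Space F := (isLocalField F).toT2Space
  rw [Subgroup.coe_center, ← Set.centralizer_univ]
  exact Set.isClosed_centralizer _

variable (F) in
/-- `Ḡ = GL₃(F) ⧸ Z` is T2 (the centre is closed ⇒ the quotient is T3). [cite: Cartier1979, §I.3] -/
theorem t2Space_quot : T2Space (GL (Fin 3) F ⧸ Subgroup.center (GL (Fin 3) F)) := by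
  haveI : IsClosed ((Subgroup.center (GL (Fin 3) F) : Set (GL (Fin 3) F))) := isClosed_center_gl3 F
  infer_instance

end Frame

/-! ## §2 Scalars and scale-invariant sets -/

section Scalars

variable {F : Type*} [Field F]

/-- `mk x = mk y` in `GL₃(F) ⧸ Z` iff `y = x · (c·1)` for a scalar `c ∈ F^×` (the centre is the scalars ★). [cite: PlatonovRapinchuk1994, §3.3] -/
theorem exists_scalar_of_mk_eq {x y : GL (Fin 3) F}
    (h : (QuotientGroup.mk x : GL (Fin 3) F ⧸ Subgroup.center (GL (Fin 3) F)) = QuotientGroup.mk y) :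
    ∃ c : Fˣ, y = x * Matrix.GeneralLinearGroup.scalar (Fin 3) c := by
  rw [QuotientGroup.eq, Matrix.GeneralLinearGroup.center_eq_range_scalar] at h
  obtain ⟨c, hc⟩ := h
  exact ⟨c, by rw [hc, mul_inv_cancel_left]⟩

/-- For a scale-invariant `S ⊆ GL₃(F)`: `mk ⁻¹' (mk '' S) = S`. [folklore] -/
theorem preimage_mk_image_eq {S : Set (GL (Fin 3) F)} (hS : ∀ (c : Fˣ) (x : GL (Fin 3) F), x ∈ S → x * Matrix.GeneralLinearGroup.scalar (Fin 3) c ∈ S) :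
    (QuotientGroup.mk : GL (Fin 3) F → GL (Fin 3) F ⧸ Subgroup.center (GL (Fin 3) F)) ⁻¹' ((QuotientGroup.mk) '' S) = S := by
  ext x
  refine ⟨fun ⟨y, hy, hyx⟩ => ?_, fun hx => ⟨x, hx, rfl⟩⟩
  obtain ⟨c, hc⟩ := exists_scalar_of_mk_eq hyx
  rw [hc]; exact hS c y hy

/-- Membership in the image of a scale-invariant set: `mk x ∈ mk '' S ↔ x ∈ S`. [folklore] -/
theorem mk_mem_image_iff {S : Set (GL (Fin 3) F)} (hS : ∀ (c : Fˣ) (x : GL (Fin 3) F), x ∈ S → x * Matrix.GeneralLinearGroup.scalar (Fin 3) c ∈ S)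
    (x : GL (Fin 3) F) :
    (QuotientGroup.mk x : GL (Fin 3) F ⧸ Subgroup.center (GL (Fin 3) F)) ∈ (QuotientGroup.mk) '' S ↔ x ∈ S := by
  rw [← Set.mem_preimage, preimage_mk_image_eq hS]

variable [TopologicalSpace F] [IsTopologicalRing F]

omit [IsTopologicalRing F] in
/-- The image of a CLOSED scale-invariant set is closed in `Ḡ` (quotient map + saturation). [folklore] -/
theorem isClosed_image_mk_of_scaleInvariant {S : Set (GL (Fin 3) F)} (hSc : IsClosed S)
    (hS : ∀ (c : Fˣ) (x : GL (Fin 3) F), x ∈ S → x * Matrix.GeneralLinearGroup.scalar (Fin 3) c ∈ S) :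
    IsClosed ((QuotientGroup.mk : GL (Fin 3) F → GL (Fin 3) F ⧸ Subgroup.center (GL (Fin 3) F)) '' S) := by
  rw [← (QuotientGroup.isQuotientMap_mk (Subgroup.center (GL (Fin 3) F))).isClosed_preimage, preimage_mk_image_eq hS]
  exact hSc

/-- The image of an OPEN set is open in `Ḡ` (the quotient map is open). [folklore] -/
theorem isOpen_image_mk {S : Set (GL (Fin 3) F)} (hSo : IsOpen S) :
    IsOpen ((QuotientGroup.mk : GL (Fin 3) F → GL (Fin 3) F ⧸ Subgroup.center (GL (Fin 3) F)) '' S) :=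
  QuotientGroup.isOpenMap_coe S hSo

end Scalars

/-! ## §3 `K̄`, the image of `GL₃(𝒪)` -/

section KBar

variable {F : Type*} [Field F] [ValuativeRel F] [TopologicalSpace F] [IsNonarchimedeanLocalField F]

variable (F) in
/-- `K̄ = image of GL₃(𝒪)` is open in `Ḡ`. [cite: Cartier1979, §IV.1] -/
theorem isOpen_kbar : IsOpen (((glInt 3 F).map (QuotientGroup.mk' (Subgroup.center (GL (Fin 3) F))) : Set (GL (Fin 3) F ⧸ Subgroup.center (GL (Fin 3) F)))) := by
  rw [Subgroup.coe_map, QuotientGroup.coe_mk']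
  exact QuotientGroup.isOpenMap_coe _ (isOpen_glInt 3 F)

variable (F) in
/-- `K̄` is compact (continuous image of the compact `GL₃(𝒪)` ★ `isCompact_glInt`). [cite: Cartier1979, §IV.1] -/
theorem isCompact_kbar : IsCompact (((glInt 3 F).map (QuotientGroup.mk' (Subgroup.center (GL (Fin 3) F))) : Set (GL (Fin 3) F ⧸ Subgroup.center (GL (Fin 3) F)))) := by
  rw [Subgroup.coe_map, QuotientGroup.coe_mk']
  exact (isCompact_glInt 3 F).image QuotientGroup.continuous_mk

end KBar

/-! ## §4 The compactness criterion for centralisers in `Ḡ` -/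

section Criterion

variable {F : Type*} [Field F] [Valued F ℤᵐ⁰] [ValuativeRel F] [(Valued.v : Valuation F ℤᵐ⁰).Compatible] [IsNonarchimedeanLocalField F]

omit [ValuativeRel F] [(Valued.v : Valuation F ℤᵐ⁰).Compatible] [IsNonarchimedeanLocalField F] in
/-- The bounded sets `U_m = {g | all entries of g and g⁻¹ have valuation ≤ exp m}` are open in `GL₃(F)`. [cite: Cartier1979, §IV.1] -/
theorem isOpen_setOf_entries_le {ϖ : F} (hϖ : Valued.v ϖ = WithZero.exp (-1 : ℤ)) (m : ℕ) :
    IsOpen {g : GL (Fin 3) F | (∀ i j, Valued.v ((g : Matrix (Fin 3) (Fin 3) F) i j) ≤ WithZero.exp (m : ℤ)) ∧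
      ∀ i j, Valued.v (((g⁻¹ : GL (Fin 3) F) : Matrix (Fin 3) (Fin 3) F) i j) ≤ WithZero.exp (m : ℤ)} := by
  have h1 : ∀ i j : Fin 3, Continuous fun g : GL (Fin 3) F => (g : Matrix (Fin 3) (Fin 3) F) i j := fun i j => Units.continuous_val.matrix_elem i j
  have h2 : ∀ i j : Fin 3, Continuous fun g : GL (Fin 3) F => ((g⁻¹ : GL (Fin 3) F) : Matrix (Fin 3) (Fin 3) F) i j :=
    fun i j => Units.continuous_coe_inv.matrix_elem i j
  have hO := SymplecticCartan.isOpen_setOf_v_le_exp hϖ m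
  simp only [Set.setOf_and, Set.setOf_forall]
  exact (isOpen_iInter_of_finite fun i => isOpen_iInter_of_finite fun j => hO.preimage (h1 i j)).inter
    (isOpen_iInter_of_finite fun i => isOpen_iInter_of_finite fun j => hO.preimage (h2 i j))

omit [(Valued.v : Valuation F ℤᵐ⁰).Compatible] in
/-- **COMPACTNESS CRITERION.**  If `X̄ ⊆ Ḡ = GL₃(F) ⧸ Z` is compact then there is `N` with `v(y i j) · v(y⁻¹ i' j') ≤ exp N` for every `y ∈ GL₃(F)` with `mk y ∈ X̄`
and all indices (a scale-invariant bound: `X̄` lies in the image of one bounded open `U_m`, and `y = u · c·1`).  Contrapositively: a subgroup of `GL₃(F)` on which these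
products are unbounded has NON-COMPACT image mod centre — the consumer of (GL-6) «block Hensel ⇒ unbounded centraliser». [cite: Cartier1979, §I.3–I.4]
[cite: PlatonovRapinchuk1994, §3.3] -/
theorem exists_bound_of_isCompact_image {ϖ : F} (hϖ : Valued.v ϖ = WithZero.exp (-1 : ℤ))
    {X : Set (GL (Fin 3) F ⧸ Subgroup.center (GL (Fin 3) F))} (hX : IsCompact X) :
    ∃ N : ℕ, ∀ y : GL (Fin 3) F, (QuotientGroup.mk y : GL (Fin 3) F ⧸ Subgroup.center (GL (Fin 3) F)) ∈ X →
      ∀ i j i' j' : Fin 3, Valued.v ((y : Matrix (Fin 3) (Fin 3) F) i j) * Valued.v (((y⁻¹ : GL (Fin 3) F) : Matrix (Fin 3) (Fin 3) F) i' j') ≤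
        WithZero.exp (2 * (N : ℤ)) := by
  -- the increasing open cover of `Ḡ` by the images of the bounded sets
  set U : ℕ → Set (GL (Fin 3) F) := fun m => {g : GL (Fin 3) F | (∀ i j, Valued.v ((g : Matrix (Fin 3) (Fin 3) F) i j) ≤ WithZero.exp (m : ℤ)) ∧
      ∀ i j, Valued.v (((g⁻¹ : GL (Fin 3) F) : Matrix (Fin 3) (Fin 3) F) i j) ≤ WithZero.exp (m : ℤ)} with hU
  have hUo : ∀ m, IsOpen ((QuotientGroup.mk : GL (Fin 3) F → GL (Fin 3) F ⧸ Subgroup.center (GL (Fin 3) F)) '' U m) :=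
    fun m => QuotientGroup.isOpenMap_coe _ (isOpen_setOf_entries_le hϖ m)
  have hmono : Monotone fun m => (QuotientGroup.mk : GL (Fin 3) F → GL (Fin 3) F ⧸ Subgroup.center (GL (Fin 3) F)) '' U m := by
    intro m m' hmm'
    refine Set.image_mono fun g hg => ⟨fun i j => (hg.1 i j).trans (WithZero.exp_le_exp.2 (by exact_mod_cast hmm')),
      fun i j => (hg.2 i j).trans (WithZero.exp_le_exp.2 (by exact_mod_cast hmm'))⟩
  have hcover : X ⊆ ⋃ m, (QuotientGroup.mk : GL (Fin 3) F → GL (Fin 3) F ⧸ Subgroup.center (GL (Fin 3) F)) '' U m := by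
    intro x _
    induction x using QuotientGroup.induction_on with
    | H g =>
      obtain ⟨m₁, hm₁⟩ := SymplecticCartan.exists_forall_v_le_exp_of_isCompact hϖ (Set.finite_range fun p : Fin 3 × Fin 3 => (g : Matrix (Fin 3) (Fin 3) F) p.1 p.2).isCompact
      obtain ⟨m₂, hm₂⟩ := SymplecticCartan.exists_forall_v_le_exp_of_isCompact hϖ
        (Set.finite_range fun p : Fin 3 × Fin 3 => ((g⁻¹ : GL (Fin 3) F) : Matrix (Fin 3) (Fin 3) F) p.1 p.2).isCompact
      refine Set.mem_iUnion.2 ⟨max m₁ m₂, g, ⟨fun i j => ?_, fun i j => ?_⟩, rfl⟩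
      · exact (hm₁ _ ⟨(i, j), rfl⟩).trans (WithZero.exp_le_exp.2 (by exact_mod_cast le_max_left m₁ m₂))
      · exact (hm₂ _ ⟨(i, j), rfl⟩).trans (WithZero.exp_le_exp.2 (by exact_mod_cast le_max_right m₁ m₂))
  obtain ⟨N, hN⟩ := hX.elim_directed_cover _ hUo hcover (Monotone.directed_le hmono)
  refine ⟨N, fun y hy i j i' j' => ?_⟩
  obtain ⟨u, hu, huy⟩ := hN hy
  obtain ⟨c, hc⟩ := exists_scalar_of_mk_eq huy
  -- `y = u · c·1`: the scalar cancels in the product of an entry of `y` with an entry of `y⁻¹`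
  have hy1 : (y : Matrix (Fin 3) (Fin 3) F) i j = (u : Matrix (Fin 3) (Fin 3) F) i j * (c : F) := by
    rw [hc, Units.val_mul, Matrix.GeneralLinearGroup.coe_scalar, Matrix.scalar_apply, Matrix.mul_diagonal]
  have hy2 : ((y⁻¹ : GL (Fin 3) F) : Matrix (Fin 3) (Fin 3) F) i' j' = ((c : F))⁻¹ * ((u⁻¹ : GL (Fin 3) F) : Matrix (Fin 3) (Fin 3) F) i' j' := by
    rw [hc, _root_.mul_inv_rev, ← map_inv, Units.val_mul, Matrix.GeneralLinearGroup.coe_scalar, Matrix.scalar_apply, Matrix.diagonal_mul,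
      Units.val_inv_eq_inv_val]
  have hc0 : Valued.v (c : F) ≠ 0 := (Valuation.ne_zero_iff _).2 c.ne_zero
  rw [hy1, hy2, map_mul, map_mul, map_inv₀]
  simp only [mul_assoc, mul_inv_cancel_left₀ hc0]
  rw [two_mul, WithZero.exp_add]
  exact mul_le_mul' (hu.1 i j) (hu.2 i' j')

end Criterion

/-! ## §5 The two-parameter Cartan cover of `Ḡ` and the entries of `t h t⁻¹` -/

section Cartan

variable {F : Type*} [Field F] [Valued F ℤᵐ⁰] [ValuativeRel F] [(Valued.v : Valuation F ℤᵐ⁰).Compatible] [IsNonarchimedeanLocalField F]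

omit [Valued F ℤᵐ⁰] [ValuativeRel F] [(Valued.v : Valuation F ℤᵐ⁰).Compatible] [IsNonarchimedeanLocalField F] in
/-- A constant power `zpowDiagGL (c, c, c)` is central, hence trivial in `Ḡ`. [folklore] -/
theorem mk_zpowDiagGL_const_eq_one {ϖ : F} (hϖ0 : ϖ ≠ 0) (c : ℤ) :
    (QuotientGroup.mk (zpowDiagGL (n := 3) hϖ0 fun _ => c) : GL (Fin 3) F ⧸ Subgroup.center (GL (Fin 3) F)) = 1 := by
  rw [QuotientGroup.eq_one_iff]
  exact Subgroup.mem_center_iff.2 fun g => mul_zpowDiagGL_const_comm hϖ0 c g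

omit [IsNonarchimedeanLocalField F] in
/-- **THE TWO-PARAMETER CARTAN COVER OF `Ḡ = GL₃(F) ⧸ Z`**: every class lies in `K̄ · mk(t_{a,b}) · K̄` for some `a ≥ b ≥ 0`, `t_{a,b} = diag(ϖ^{−a}, ϖ^{−b}, 1)`
(★ `exists_glInt_mul_mul_eq_zpowDiagGL` applied to `g⁻¹`: `k₁ g⁻¹ k₂ = diag(ϖ^{a₀}, ϖ^{a₁}, ϖ^{a₂})` with `a₀ ≥ a₁ ≥ a₂`, so `g = k₂ · diag(ϖ^{−a₀}, ϖ^{−a₁}, ϖ^{−a₂}) · k₁`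
`= k₂ · (ϖ^{−a₂}·1) · t_{a₀−a₂, a₁−a₂} · k₁`). [cite: BruhatTits1972, (4.4.3)] [cite: Bump1997, Thm. 3.3.3] -/
theorem exists_mem_doubleCoset_mk_tPair {ϖ : F} (hϖ : Valued.v ϖ = WithZero.exp (-1 : ℤ)) (hϖ0 : ϖ ≠ 0)
    (x : GL (Fin 3) F ⧸ Subgroup.center (GL (Fin 3) F)) :
    ∃ p : {p : ℕ × ℕ // p.2 ≤ p.1},
      x ∈ ((glInt 3 F).map (QuotientGroup.mk' (Subgroup.center (GL (Fin 3) F))) : Set (GL (Fin 3) F ⧸ Subgroup.center (GL (Fin 3) F))) *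
        {QuotientGroup.mk' (Subgroup.center (GL (Fin 3) F)) (zpowDiagGL (n := 3) hϖ0 ![-(p.1.1 : ℤ), -(p.1.2 : ℤ), 0])} *
        ((glInt 3 F).map (QuotientGroup.mk' (Subgroup.center (GL (Fin 3) F))) : Set (GL (Fin 3) F ⧸ Subgroup.center (GL (Fin 3) F))) := by
  haveI := isDiscreteValuationRing_integer_of_compatible hϖ
  have hu : IsUniformizingElement ϖ := isUniformizingElement_of_v_eq hϖ
  induction x using QuotientGroup.induction_on with
  | H g =>
    obtain ⟨k₁, hk₁, k₂, hk₂, a, ha, heq⟩ := exists_glInt_mul_mul_eq_zpowDiagGL hu g⁻¹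
    have h21 : a 2 ≤ a 1 := ha (by decide)
    have h10 : a 1 ≤ a 0 := ha (by decide)
    refine ⟨⟨((a 0 - a 2).toNat, (a 1 - a 2).toNat), ?_⟩, ?_⟩
    · simp only
      exact Int.toNat_le_toNat (by omega)
    -- `g = k₂ · zpowDiagGL (−a) · k₁` and `zpowDiagGL (−a) = (ϖ^{−a₂}·1) · t`
    have hg : g = k₂ * zpowDiagGL hϖ0 (-a) * k₁ := by
      have h1 : g⁻¹ = k₁⁻¹ * zpowDiagGL hϖ0 a * k₂⁻¹ := by
        rw [← heq]; group
      have h2 := congrArg Inv.inv h1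
      rw [inv_inv] at h2
      rw [h2, zpowDiagGL_neg]; group
    have hsplit : (-a) = (fun _ : Fin 3 => -(a 2)) + ![-(((a 0 - a 2).toNat : ℕ) : ℤ), -(((a 1 - a 2).toNat : ℕ) : ℤ), 0] := by
      funext i
      rw [Int.toNat_of_nonneg (by omega), Int.toNat_of_nonneg (by omega)]
      fin_cases i <;> simp <;> ring
    have hmk : (QuotientGroup.mk g : GL (Fin 3) F ⧸ Subgroup.center (GL (Fin 3) F)) =
        QuotientGroup.mk k₂ * QuotientGroup.mk' (Subgroup.center (GL (Fin 3) F)) (zpowDiagGL (n := 3) hϖ0 ![-(((a 0 - a 2).toNat : ℕ) : ℤ), -(((a 1 - a 2).toNat : ℕ) : ℤ), 0]) *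
          QuotientGroup.mk k₁ := by
      rw [QuotientGroup.mk'_apply, hg, hsplit, zpowDiagGL_add, QuotientGroup.mk_mul, QuotientGroup.mk_mul, QuotientGroup.mk_mul, mk_zpowDiagGL_const_eq_one, one_mul]
    rw [hmk]
    exact Set.mem_mul.2 ⟨_, Set.mem_mul.2 ⟨_, ⟨k₂, hk₂, rfl⟩, _, Set.mem_singleton _, rfl⟩, _, ⟨k₁, hk₁, rfl⟩, rfl⟩

omit [Valued F ℤᵐ⁰] [ValuativeRel F] [(Valued.v : Valuation F ℤᵐ⁰).Compatible] [IsNonarchimedeanLocalField F] in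
/-- **Entries of `t h t⁻¹`** for `t = zpowDiagGL e`: `(t h t⁻¹)ᵢⱼ = ϖ^{eᵢ} · hᵢⱼ · ϖ^{−eⱼ}`. [folklore] -/
theorem coe_conj_zpowDiagGL_apply {ϖ : F} (hϖ0 : ϖ ≠ 0) (e : Fin 3 → ℤ) (h : GL (Fin 3) F) (i j : Fin 3) :
    ((zpowDiagGL hϖ0 e * h * (zpowDiagGL hϖ0 e)⁻¹ : GL (Fin 3) F) : Matrix (Fin 3) (Fin 3) F) i j =
      ϖ ^ e i * (h : Matrix (Fin 3) (Fin 3) F) i j * ϖ ^ (-e j) := by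
  rw [← zpowDiagGL_neg, Units.val_mul, Units.val_mul, coe_zpowDiagGL, coe_zpowDiagGL, Matrix.mul_diagonal, Matrix.diagonal_mul, Pi.neg_apply]

omit [ValuativeRel F] [(Valued.v : Valuation F ℤᵐ⁰).Compatible] [IsNonarchimedeanLocalField F] in
/-- **Valuations of the entries of `t h t⁻¹`**: `v((t h t⁻¹)ᵢⱼ) = exp(−eᵢ) · exp(eⱼ) · v(hᵢⱼ)` for `t = zpowDiagGL e`, `v(ϖ) = exp(−1)`. [folklore] -/
theorem v_conj_zpowDiagGL_apply {ϖ : F} (hϖ : Valued.v ϖ = WithZero.exp (-1 : ℤ)) (hϖ0 : ϖ ≠ 0) (e : Fin 3 → ℤ) (h : GL (Fin 3) F) (i j : Fin 3) :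
    Valued.v (((zpowDiagGL hϖ0 e * h * (zpowDiagGL hϖ0 e)⁻¹ : GL (Fin 3) F) : Matrix (Fin 3) (Fin 3) F) i j) =
      WithZero.exp (-e i) * WithZero.exp (e j) * Valued.v ((h : Matrix (Fin 3) (Fin 3) F) i j) := by
  rw [coe_conj_zpowDiagGL_apply, map_mul, map_mul, map_zpow₀, map_zpow₀, hϖ, ← WithZero.exp_zsmul, ← WithZero.exp_zsmul, smul_eq_mul, smul_eq_mul,
    mul_neg_one, mul_neg_one, neg_neg]
  simp only [mul_assoc, mul_comm]

omit [ValuativeRel F] [(Valued.v : Valuation F ℤᵐ⁰).Compatible] [IsNonarchimedeanLocalField F] in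
/-- **SMALL ENTRIES FROM THE BOX CONDITION** for `t_{a,b} = zpowDiagGL ![−a, −b, 0]`: if every entry of `t h t⁻¹` has valuation `≤ exp M`, then
`v(h₀₁) ≤ exp(M − (a − b))`, `v(h₀₂) ≤ exp(M − a)`, `v(h₁₂) ≤ exp(M − b)` (the three upper entries; `a ≥ b ≥ 0` in the application). [cite: HarishChandra1970, Part V §3] -/
theorem v_upper_le_of_conj_tPair {ϖ : F} (hϖ : Valued.v ϖ = WithZero.exp (-1 : ℤ)) (hϖ0 : ϖ ≠ 0) (a b M : ℕ) (h : GL (Fin 3) F)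
    (hb : ∀ i j, Valued.v (((zpowDiagGL hϖ0 ![-(a : ℤ), -(b : ℤ), 0] * h * (zpowDiagGL hϖ0 ![-(a : ℤ), -(b : ℤ), 0])⁻¹ : GL (Fin 3) F) :
      Matrix (Fin 3) (Fin 3) F) i j) ≤ WithZero.exp (M : ℤ)) :
    Valued.v ((h : Matrix (Fin 3) (Fin 3) F) 0 1) ≤ WithZero.exp ((M : ℤ) - ((a : ℤ) - b)) ∧
      Valued.v ((h : Matrix (Fin 3) (Fin 3) F) 0 2) ≤ WithZero.exp ((M : ℤ) - a) ∧
        Valued.v ((h : Matrix (Fin 3) (Fin 3) F) 1 2) ≤ WithZero.exp ((M : ℤ) - b) := by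
  have key : ∀ (x : F) (c : ℤ), WithZero.exp c * Valued.v x ≤ WithZero.exp (M : ℤ) → Valued.v x ≤ WithZero.exp ((M : ℤ) - c) := by
    intro x c hx
    calc Valued.v x = WithZero.exp (-c) * (WithZero.exp c * Valued.v x) := by
          rw [← mul_assoc, ← WithZero.exp_add, neg_add_cancel, WithZero.exp_zero, one_mul]
      _ ≤ WithZero.exp (-c) * WithZero.exp (M : ℤ) := mul_le_mul' le_rfl hx
      _ = WithZero.exp ((M : ℤ) - c) := by rw [← WithZero.exp_add, neg_add_eq_sub]
  have h01 := hb 0 1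
  have h02 := hb 0 2
  have h12 := hb 1 2
  rw [v_conj_zpowDiagGL_apply hϖ hϖ0, ← WithZero.exp_add] at h01 h02 h12
  simp only [Fin.isValue, Matrix.cons_val_zero, Matrix.cons_val_one, Matrix.cons_val, neg_neg, add_zero] at h01 h02 h12
  refine ⟨key _ _ ?_, key _ _ h02, key _ _ h12⟩
  rw [show (a : ℤ) - b = a + -(b : ℤ) by ring]
  exact h01

end Cartan

end Summit.HodgeConjecture.HodgeConjecture.Cruxes.H413.K2E3GL3ModCentre

end
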